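import Summits.HubbardSuperconductivity.HubbardSuperconductivity.Theorems.AnisotropyChordTransferFibre3TwoHoleBSRobust
import Summits.HubbardSuperconductivity.HubbardSuperconductivity.Theorems.AnisotropyChordTransferFibre3TwoHoleGapReduce

/-!
# Route `AnisotropyChord` / H0 rotor rung: PROP BS — CAPACITY ROBUSTNESS (an upper bound on the torus capacity suffices) and the bridge to p1's real single-pair form

Ninth file of PROP BS (memo ROTOR-THEORY-21 §314(d)(iii), §317(d), §324(f); theory seat `hubbard-h0-rotor-theory-1`).  In the ∀L
tail the torus capacity `Λ̃_L = G̃_{¾ε₁}(0) ~ (1/2π) ln L + c` is known only through BOUNDS.  This file removes the exact capacity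
from the skeleton certificate of `…Fibre3TwoHoleBSRobust`:
* `smInv_mulVec_pad_emb`, `smInv_quad_pad` (`(Eŵ)·ŵ = wᵀ·twoHoleP A Λ·w + ½|w|²` for `E = smInv A Λ`), `quad_J10` (`yᵀ11ᵀy = (Σy)²`);
* ★★ `matrixCert_of_skeleton_capUpper` / `dualCert_of_skeleton_capUpper`: with a symmetric invertible model kernel `A∞` within `δ`
  of `A_L`, a capacity UPPER bound `Λ_up ≥ Λ̃_L` (`Λ_up·s ≠ 1`) and the FIXED charge map `E = smInv A∞ Λ_up`, the condition
  `δ·(Σ_p|(Eŵ)_p|)² ≤ wᵀ·twoHoleP A∞ Λ_up·w` (all real boundary `w`) certifies the pair — the true capacity only contributes the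
  bonus `(Λ_up − Λ̃_L)(ΣEŵ)² ≥ 0`.  Inputs of the HOLE₂ tail are thus: `A∞`, `δ_L`, `Λ_up(L)`, one margin inequality per class;
* `twoHoleP_quad_sub`, ★ `twoHoleP_quad_mono`: `twoHoleP A ·` is Loewner-decreasing in the capacity (`Λ' ≤ Λ`, `Λ's, Λs > 1`);
* ★ `twoHoleGapRealAt_of_dualCert`: a dual certificate at `(z₁, z₂)` gives p1 g24's `TwoHoleGapRealAt L g z₁ z₂`
  (`…Fibre3TwoHoleGapReduce`), so BS certificates also feed `twoHoleGap_of_reps`.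
Prover seat `hubbard-h0-rotor-p2` g2; helper for stmt-HubbardSuperconductivity-19089 (`--supports`, helper class).
WHAT THIS IS NOT: nothing here proves superconductivity in the Hubbard model; the rotor TARGET as originally worded stays
FALSE (g15 verdict).  Finite algebra behind ONE input (HOLE₂) of ONE conditional reduction (rung 19089); it certifies no pair by
itself.  Mathlib + tree imports only; no sorry, no axioms.
-/

set_option linter.dupNamespace false

noncomputable section

open scoped BigOperators
open Complex Finset

namespace Summit.HubbardSuperconductivity.HubbardSuperconductivity.Theorems.AnisotropyChord.Transfer.Fibre3

namespace TwoHoleBS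

variable (L : ℕ) [NeZero L]

/-! ## Capacity robustness: an UPPER bound on the torus capacity suffices (fixed Sherman–Morrison charge map at the reference capacity) -/

omit [NeZero L] in
/-- sums over the ten slots of a real function vanishing at the centres. [folklore] -/
theorem sum_eq_sum_emb_real {F : Fin 5 ⊕ Fin 5 → ℝ} (h1 : F (Sum.inl 0) = 0) (h2 : F (Sum.inr 0) = 0) :
    ∑ p : Fin 5 ⊕ Fin 5, F p = ∑ i : Fin 4 ⊕ Fin 4, F (TwoChannel.emb i) := by
  have := sum_eq_sum_emb (F := fun p => ((F p : ℝ) : ℂ)) (by simp [h1]) (by simp [h2])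
  exact_mod_cast this

omit [NeZero L] in
/-- the Sherman–Morrison charge map on padded boundary data: `(E ŵ)_{emb i} = (twoHoleP A Λ w)_i + ½ w_i`. [folklore] -/
theorem smInv_mulVec_pad_emb (A : Matrix (Fin 5 ⊕ Fin 5) (Fin 5 ⊕ Fin 5) ℝ) (Λ : ℝ) (w : Fin 4 ⊕ Fin 4 → ℝ)
    (i : Fin 4 ⊕ Fin 4) :
    (smInv A Λ).mulVec (pad w) (TwoChannel.emb i)
      = (TwoChannel.twoHoleP A Λ).mulVec w i + (1 / 2 : ℝ) * w i := by
  simp only [Matrix.mulVec, dotProduct]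
  have h := sum_eq_sum_emb_real (F := fun q => smInv A Λ (TwoChannel.emb i) q * pad w q)
    (by simp [(pad_centre w).1]) (by simp [(pad_centre w).2])
  beta_reduce at h
  rw [h]
  simp only [pad_emb, smInv_emb, add_mul, Finset.sum_add_distrib, ite_mul, zero_mul,
    Finset.sum_ite_eq, Finset.mem_univ, if_true]

omit [NeZero L] in
/-- `(E ŵ)·ŵ = wᵀ(twoHoleP A Λ)w + ½|w|²` for the Sherman–Morrison charge map `E = smInv A Λ`. [folklore] -/
theorem smInv_quad_pad (A : Matrix (Fin 5 ⊕ Fin 5) (Fin 5 ⊕ Fin 5) ℝ) (Λ : ℝ) (w : Fin 4 ⊕ Fin 4 → ℝ) :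
    dotProduct ((smInv A Λ).mulVec (pad w)) (pad w)
      = dotProduct w ((TwoChannel.twoHoleP A Λ).mulVec w) + (1 / 2 : ℝ) * ∑ i : Fin 4 ⊕ Fin 4, w i ^ 2 := by
  have h := sum_eq_sum_emb_real (F := fun p => (smInv A Λ).mulVec (pad w) p * pad w p)
    (by simp [(pad_centre w).1]) (by simp [(pad_centre w).2])
  beta_reduce at h
  unfold dotProduct
  rw [h]
  simp only [pad_emb, smInv_mulVec_pad_emb, Finset.mul_sum, ← Finset.sum_add_distrib]
  refine Finset.sum_congr rfl fun i _ => ?_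
  ring

omit [NeZero L] in
/-- the all-ones form is a square: `yᵀ·11ᵀ·y = (Σ y)²`. [folklore] -/
theorem quad_J10 (y : Fin 5 ⊕ Fin 5 → ℝ) : dotProduct y (J10.mulVec y) = (∑ p : Fin 5 ⊕ Fin 5, y p) ^ 2 := by
  simp only [dotProduct, Matrix.mulVec, J10, Matrix.of_apply, one_mul]
  rw [sq, Finset.sum_mul]

/-- ★ **SKELETON + UPPER CAPACITY BOUND ⇒ certificate:** let `A∞` be a symmetric invertible model kernel within `δ` of `A_L`, and
`Λ_up ≥ Λ̃_L` a capacity UPPER bound with `Λ_up·s ≠ 1`.  With the FIXED charge map `E = smInv A∞ Λ_up` (no `L`-dependence), if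
`δ·(Σ_p |(E ŵ)_p|)² ≤ wᵀ·twoHoleP A∞ Λ_up·w` for all real boundary `w`, then `MatrixCert L g z₁ z₂ E`.
(The exact capacity only adds the bonus `(Λ_up − Λ̃_L)(Σ Eŵ)² ≥ 0`; `twoHoleP` is Loewner-decreasing in the capacity.)
This is the L-uniform form in which the HOLE₂ tail (memo 21 §317(d), §321) is to be instantiated: inputs `A∞` (ℤ² skeleton),
`δ_L` (rate lemma + periodisation), `Λ_up(L)` (capacity asymptotics), and ONE positivity-with-margin statement per pair class. [folklore] -/
theorem matrixCert_of_skeleton_capUpper (g : ℝ) (z₁ z₂ : Tor L) (Ainf : Matrix (Fin 5 ⊕ Fin 5) (Fin 5 ⊕ Fin 5) ℝ)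
    (hs : Ainf.IsSymm) (hA : IsUnit Ainf.det) (Λup : ℝ) (hΛ : Λup * TwoChannel.svec2 Ainf - 1 ≠ 0)
    (hcap : capT L g ≤ Λup) (δ : ℝ) (hδ : ∀ p q, |kerMat L g z₁ z₂ p q - Ainf p q| ≤ δ)
    (hpos : ∀ w : Fin 4 ⊕ Fin 4 → ℝ,
      δ * (∑ p : Fin 5 ⊕ Fin 5, |(smInv Ainf Λup).mulVec (pad w) p|) ^ 2
        ≤ dotProduct w ((TwoChannel.twoHoleP Ainf Λup).mulVec w)) :
    MatrixCert L g z₁ z₂ ((smInv Ainf Λup).map Complex.ofReal) := by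
  apply matrixCert_of_model L g z₁ z₂ _ Ainf δ hδ
  intro w
  have hprod := capJ_sub_mul_smInv Ainf hs hA Λup hΛ
  have hGE : (Λup • J10 - Ainf).mulVec ((smInv Ainf Λup).mulVec (pad w)) = pad w := by
    rw [Matrix.mulVec_mulVec, hprod, Matrix.one_mulVec]
  -- split the model Green matrix at the true capacity as (reference) − (Λ_up − Λ̃)·11ᵀ
  have hsplit : ∀ y : Fin 5 ⊕ Fin 5 → ℝ, (capT L g • J10 - Ainf).mulVec y
      = (Λup • J10 - Ainf).mulVec y - (Λup - capT L g) • J10.mulVec y := by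
    intro y
    rw [← Matrix.smul_mulVec, ← Matrix.sub_mulVec]
    congr 1
    ext p q
    simp only [Matrix.sub_apply, Matrix.smul_apply, smul_eq_mul]
    ring
  rw [hsplit, hGE, dotProduct_sub, dotProduct_smul, smul_eq_mul, quad_J10, smInv_quad_pad]
  have hb : 0 ≤ (Λup - capT L g) * (∑ p : Fin 5 ⊕ Fin 5, (smInv Ainf Λup).mulVec (pad w) p) ^ 2 :=
    mul_nonneg (by linarith) (sq_nonneg _)
  have := hpos w
  linarith

/-- **dual certificate from skeleton + upper capacity bound.** [folklore] -/
theorem dualCert_of_skeleton_capUpper (g : ℝ) (z₁ z₂ : Tor L) (Ainf : Matrix (Fin 5 ⊕ Fin 5) (Fin 5 ⊕ Fin 5) ℝ)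
    (hs : Ainf.IsSymm) (hA : IsUnit Ainf.det) (Λup : ℝ) (hΛ : Λup * TwoChannel.svec2 Ainf - 1 ≠ 0)
    (hcap : capT L g ≤ Λup) (δ : ℝ) (hδ : ∀ p q, |kerMat L g z₁ z₂ p q - Ainf p q| ≤ δ)
    (hpos : ∀ w : Fin 4 ⊕ Fin 4 → ℝ,
      δ * (∑ p : Fin 5 ⊕ Fin 5, |(smInv Ainf Λup).mulVec (pad w) p|) ^ 2
        ≤ dotProduct w ((TwoChannel.twoHoleP Ainf Λup).mulVec w)) :
    DualCert L g z₁ z₂ :=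
  dualCert_of_matrixCert L (matrixCert_of_skeleton_capUpper L g z₁ z₂ Ainf hs hA Λup hΛ hcap δ hδ hpos)

omit [NeZero L] in
/-- the capacity dependence of `twoHoleP` is the rank-one term: the difference of the quadratic forms at two capacities is
`[Λ/(Λs−1) − Λ'/(Λ's−1)]·(x_B·w)²`. [folklore] -/
theorem twoHoleP_quad_sub (A : Matrix (Fin 5 ⊕ Fin 5) (Fin 5 ⊕ Fin 5) ℝ) (Λ Λ' : ℝ) (w : Fin 4 ⊕ Fin 4 → ℝ) :
    dotProduct w ((TwoChannel.twoHoleP A Λ).mulVec w) - dotProduct w ((TwoChannel.twoHoleP A Λ').mulVec w)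
      = (Λ / (Λ * TwoChannel.svec2 A - 1) - Λ' / (Λ' * TwoChannel.svec2 A - 1))
        * (∑ i : Fin 4 ⊕ Fin 4, TwoChannel.xvec2 A (TwoChannel.emb i) * w i) ^ 2 := by
  rw [← dotProduct_sub, ← Matrix.sub_mulVec]
  have hM : TwoChannel.twoHoleP A Λ - TwoChannel.twoHoleP A Λ'
      = (Λ / (Λ * TwoChannel.svec2 A - 1) - Λ' / (Λ' * TwoChannel.svec2 A - 1))
        • Matrix.vecMulVec (fun i => TwoChannel.xvec2 A (TwoChannel.emb i))
            (fun i => TwoChannel.xvec2 A (TwoChannel.emb i)) := by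
    ext i j
    simp only [TwoChannel.twoHoleP, Matrix.sub_apply, Matrix.of_apply, Matrix.smul_apply, Matrix.vecMulVec_apply,
      smul_eq_mul]
    ring
  rw [hM]
  simp only [dotProduct, Matrix.mulVec, Matrix.smul_apply, Matrix.vecMulVec_apply, smul_eq_mul]
  rw [sq, Finset.sum_mul_sum, Finset.mul_sum]
  refine Finset.sum_congr rfl fun i _ => ?_
  rw [Finset.mul_sum, Finset.mul_sum]
  refine Finset.sum_congr rfl fun j _ => ?_
  ring

omit [NeZero L] in
/-- ★ `twoHoleP A ·` is Loewner-DECREASING in the capacity: for `Λ' ≤ Λ` with `Λ's − 1 > 0` and `Λs − 1 > 0`,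
`wᵀ·twoHoleP A Λ·w ≤ wᵀ·twoHoleP A Λ'·w` (memo 21 §324(f); companion of PartN40's `capacity_decomposition`). [folklore] -/
theorem twoHoleP_quad_mono (A : Matrix (Fin 5 ⊕ Fin 5) (Fin 5 ⊕ Fin 5) ℝ) {Λ Λ' : ℝ} (hle : Λ' ≤ Λ)
    (h' : 0 < Λ' * TwoChannel.svec2 A - 1) (h : 0 < Λ * TwoChannel.svec2 A - 1) (w : Fin 4 ⊕ Fin 4 → ℝ) :
    dotProduct w ((TwoChannel.twoHoleP A Λ).mulVec w) ≤ dotProduct w ((TwoChannel.twoHoleP A Λ').mulVec w) := by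
  have hd := twoHoleP_quad_sub A Λ Λ' w
  set s := TwoChannel.svec2 A
  have hX : 0 ≤ (∑ i : Fin 4 ⊕ Fin 4, TwoChannel.xvec2 A (TwoChannel.emb i) * w i) ^ 2 := sq_nonneg _
  have hcoef : Λ / (Λ * s - 1) - Λ' / (Λ' * s - 1) ≤ 0 := by
    rw [div_sub_div _ _ h.ne' h'.ne']
    apply div_nonpos_of_nonpos_of_nonneg
    · nlinarith
    · positivity
  nlinarith [mul_nonpos_of_nonpos_of_nonneg hcoef hX]

/-! ## Bridge to p1's real single-pair form -/

/-- ★ a dual certificate at `(z₁, z₂)` gives p1's real single-pair inequality `TwoHoleGapRealAt L g z₁ z₂` (`2 ≤ L`, `g < ε₁`) —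
so the Birman–Schwinger certificates also feed `twoHoleGap_of_reps`. [folklore] -/
theorem twoHoleGapRealAt_of_dualCert (hL : 2 ≤ L) {g : ℝ} (hg : g < eps1 L) {z₁ z₂ : Tor L} (hne : z₁ ≠ z₂)
    (h : DualCert L g z₁ z₂) : TwoHoleGapRealAt L g z₁ z₂ := by
  intro u hmean
  set f : Tor L → ℂ := fun x => ((u x : ℝ) : ℂ) with hf
  have hφ1 : cut L z₁ z₂ f z₁ = 0 := by simp [cut]
  have hφ2 : cut L z₁ z₂ f z₂ = 0 := by simp [cut]
  have hsum : ∑ x : Tor L, cut L z₁ z₂ f x = 0 := by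
    have : ∑ x : Tor L, cut L z₁ z₂ f x = (((∑ x : Tor L, (if (x = z₁ ∨ x = z₂) then (0 : ℝ) else u x)) : ℝ) : ℂ) := by
      push_cast
      refine Finset.sum_congr rfl fun x _ => ?_
      unfold cut
      split_ifs <;> simp [hf]
    rw [this, hmean]; simp
  obtain ⟨c, hc⟩ := h (cut L z₁ z₂ f) hφ1 hφ2 hsum
  have hd := dual_bound L hL hg (cut L z₁ z₂ f) c hsum
  have hguard := guarded_sum_eq L hne f
  -- translate the complex statement about `f` back to `u`
  have hn : ∑ x : Tor L, (if (x = z₁ ∨ x = z₂) then (0 : ℝ) else u x ^ 2)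
      = ∑ x : Tor L, ‖cut L z₁ z₂ f x‖ ^ 2 := by
    refine Finset.sum_congr rfl fun x _ => ?_
    rw [norm_cut_sq]
    split_ifs <;> simp [hf, sq_abs]
  have hb : ∀ x e : Tor L, (if (x = z₁ ∨ x = z₂ ∨ x + e = z₁ ∨ x + e = z₂) then (0 : ℝ) else (u x - u (x + e)) ^ 2)
      = (if (x = z₁ ∨ x = z₂ ∨ x + e = z₁ ∨ x + e = z₂) then (0 : ℝ) else ‖f x - f (x + e)‖ ^ 2) := by
    intro x e
    split_ifs
    · rfl
    · rw [hf]; push_cast; rw [← Complex.ofReal_sub, Complex.norm_real, Real.norm_eq_abs, sq_abs]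
  simp_rw [hb]
  rw [hguard, hn]
  linarith

end TwoHoleBS

end Summit.HubbardSuperconductivity.HubbardSuperconductivity.Theorems.AnisotropyChord.Transfer.Fibre3

end
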